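import Literature.Analysis.FluidPDE.CheskidovShvydkoyRegular
import HarnessLib

/-!
# Maximal enstrophy at prescribed energy–enstrophy budget (Lu–Doering 2008; Ayala–Protas 2017; Kang–Yun–Protas 2020)

Analysis/FluidPDE definitions file. The *extreme-enstrophy programme* studies the largest
enstrophy `𝓔(t) = ∫|∇u(t)|²` (up to the authors' factor conventions) a three-dimensional
Navier–Stokes flow can reach from data of prescribed size: Lu–Doering 2008 (Indiana Univ. Math.
J. 57, §1 and the main estimate: the instantaneous bound `d𝓔/dt ≤ c 𝓔³` is sharp, maximisers
computed), Ayala–Protas 2017 (J. Fluid Mech. 818, §2, the finite-time problem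
`max_{u₀, 𝓔(u₀) = 𝓔₀} 𝓔(T)`), Kang–Yun–Protas 2020 (J. Fluid Mech. 893, §2 Problem 1 and §5:
the maximal finite-time growth found is finite and scales like `𝓔₀^{3/2}`). This file renders
the VALUE FUNCTION of that programme, with a joint energy–enstrophy budget and a running horizon,
over the tree's Leray–Hopf notions (`IsLerayHopfOn`, `eEnergy`, `eWeakGradL2Sq`,
`IsWeaklyDivFree`):

* `IsLerayHopfTrajectory ν T' u`: a Leray–Hopf weak solution `u` of the unforced system on
  `ℝ³ × [0, T')`, `T' > 0`, issued from its own slice `u 0`, a weakly divergence-free datum — the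
  admissible class. No regularity is built in: whenever the value below is finite every admissible
  flow is a strong solution on the observation window (weak–strong uniqueness), so nothing is lost,
  while `H¹`-limits of maximising sequences remain admissible (they need not be smooth or rapidly
  decaying);
* `enstrophyValues ν E Z T` and `maxEnstrophy ν E Z T = 𝒵_ν(E, Z, T) ∈ [0, ∞]`: the set, and the
  supremum, of the observed enstrophies `eWeakGradL2Sq (u t)` over admissible `(T', u)` with
  `∫|u 0|² ≤ E`, `‖∇(u 0)‖²_{L²} ≤ Z` and observation times `0 ≤ t ≤ T`, `t < T'` (closed
  observation window, so that short-horizon suprema can be attained);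
* `IsMaxEnstrophyAttained ν E Z T`: an admissible flow realises the supremum;
* `ProfileSplitData J`, `IsProfileSplitSequence ν E Z T ε D`: a sequence of admissible flows
  whose data split into `J` fixed `H¹` profiles travelling apart plus a remainder which is
  asymptotically `L²`-weakly orthogonal to every profile frame, `ε`-small in the critical norm
  `L³` in the limit, with asymptotically orthogonal enstrophy budgets — the finite extraction, at
  precision `ε`, of the profile decomposition of a bounded sequence of `H¹(ℝ³)` modulo
  translations (Lions 1984, Lemma I.1; Gérard 1998, Thm. 1.1; for Navier–Stokes data Gallagher
  2001, Thm. 1). Only the SHAPE of such a sequence is defined here; that maximising sequences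
  admit one is a statement of the summit route using this file, not a fact of this file.

Elementary API (proved): the introduction rule `eWeakGradL2Sq_le_maxEnstrophy` and the
monotonicity `maxEnstrophy_mono` of `𝒵` in `(E, Z, T)`.

Design choices. Budgets are `ℝ≥0` (an infinite energy budget would make maximising sequences
unbounded in `L²`); the value is `ℝ≥0∞`-valued (`sSup`, no finiteness claimed); enstrophy is the
tree's `eWeakGradL2Sq` (`= ∞` off `H¹`), so profiles and data live in the tree's `H¹` ecosystem
(`eH1NormSq = eEnergy + eWeakGradL2Sq`, `CheskidovShvydkoyRegular`). Everything is on `ℝ³`.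

Deliberately NOT here: any claim about finiteness, attainment, symmetry or size of `𝒵` (open;
these are route statements), the Euler–Lagrange / adjoint system of the maximisation problem
(Ayala–Protas 2017, §3) and all numerics (Kang–Yun–Protas 2020, §§4–5).
-/

noncomputable section

open MeasureTheory Set Filter Topology
open scoped ENNReal NNReal RealInnerProductSpace

namespace Literature.Analysis.FluidPDE

/-- Local notation for Euclidean `ℝ³`. -/
local notation "ℝ³" => EuclideanSpace ℝ (Fin 3)

section Trajectories

/-- **Admissible trajectory** of the extreme-enstrophy problem (Ayala–Protas 2017, §2: flows of
the unforced Navier–Stokes system on the whole observation window, here in Leray–Hopf form):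
`u` is a Leray–Hopf weak solution with viscosity `ν`, zero force, on `ℝ³ × [0, T')` with
`T' > 0`, issued from its own time-zero slice `u 0`, which is weakly divergence free. The energy
and enstrophy budgets are imposed separately (`enstrophyValues`). [cite: AyalaProtas2017, §2] -/
structure IsLerayHopfTrajectory (ν T' : ℝ) (u : ℝ → ℝ³ → ℝ³) : Prop where
  /-- The lifespan is positive. -/
  pos : 0 < T'
  /-- The datum `u 0` is weakly divergence free (`∫ ⟪u 0, ∇θ⟫ = 0` for test functions `θ`). -/
  divFree : IsWeaklyDivFree (u 0)
  /-- `u` is a Leray–Hopf weak solution on `[0, T')` from `u 0` (accepted `IsLerayHopfOn`). -/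
  lerayHopf : IsLerayHopfOn T' ν 0 (u 0) u

/-- The **observed enstrophies at budget `(E, Z)` up to time `T`**: the values
`‖∇u(t)‖²_{L²} = eWeakGradL2Sq (u t)` along admissible trajectories `(T', u)` whose datum has
energy `∫|u 0|² ≤ E` and enstrophy `‖∇(u 0)‖²_{L²} ≤ Z`, at observation times `0 ≤ t ≤ T` inside
the lifespan, `t < T'` (Ayala–Protas 2017, §2, objective `𝓔(T)` under the constraint
`𝓔(u₀) = 𝓔₀`; Kang–Yun–Protas 2020, §2 Problem 1; inequality constraints and the extra energy
budget make the value monotone, `enstrophyValues_mono`). [cite: KangYunProtas2020, §2 Problem 1] -/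
def enstrophyValues (ν : ℝ) (E Z : ℝ≥0) (T : ℝ) : Set ℝ≥0∞ :=
  {z | ∃ (T' : ℝ) (u : ℝ → ℝ³ → ℝ³) (t : ℝ), IsLerayHopfTrajectory ν T' u ∧
      eEnergy (u 0) ≤ E ∧ eWeakGradL2Sq (u 0) ≤ Z ∧ 0 ≤ t ∧ t ≤ T ∧ t < T' ∧
      z = eWeakGradL2Sq (u t)}

/-- **Maximal enstrophy** `𝒵_ν(E, Z, T) = sup (enstrophyValues ν E Z T) ∈ [0, ∞]`: the largest
enstrophy reachable by time `T` from data of energy `≤ E` and enstrophy `≤ Z` — the value function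
of the finite-time extreme-enstrophy problem (Lu–Doering 2008, §1; Ayala–Protas 2017, §2;
Kang–Yun–Protas 2020, §2 Problem 1), `⊤` when unbounded, `0` over the empty set.
[cite: LuDoering2008, §1] -/
def maxEnstrophy (ν : ℝ) (E Z : ℝ≥0) (T : ℝ) : ℝ≥0∞ :=
  sSup (enstrophyValues ν E Z T)

/-- Introduction rule: an observed enstrophy is at most the maximal enstrophy. [folklore] -/
theorem eWeakGradL2Sq_le_maxEnstrophy {ν T' T t : ℝ} {E Z : ℝ≥0} {u : ℝ → ℝ³ → ℝ³}
    (hu : IsLerayHopfTrajectory ν T' u) (hE : eEnergy (u 0) ≤ E)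
    (hZ : eWeakGradL2Sq (u 0) ≤ Z) (h0 : 0 ≤ t) (htT : t ≤ T) (htT' : t < T') :
    eWeakGradL2Sq (u t) ≤ maxEnstrophy ν E Z T :=
  le_sSup ⟨T', u, t, hu, hE, hZ, h0, htT, htT', rfl⟩

/-- The observed enstrophies grow with the budgets and the horizon. [folklore] -/
theorem enstrophyValues_mono {ν : ℝ} {E E' Z Z' : ℝ≥0} {T T' : ℝ} (hE : E ≤ E') (hZ : Z ≤ Z')
    (hT : T ≤ T') : enstrophyValues ν E Z T ⊆ enstrophyValues ν E' Z' T' := by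
  rintro z ⟨S, u, t, hu, h₁, h₂, h₃, h₄, h₅, rfl⟩
  exact ⟨S, u, t, hu, h₁.trans (by exact_mod_cast hE), h₂.trans (by exact_mod_cast hZ), h₃,
    h₄.trans hT, h₅, rfl⟩

/-- **Monotonicity** of the maximal enstrophy in the energy budget, the enstrophy budget and the
horizon. [folklore] -/
theorem maxEnstrophy_mono {ν : ℝ} {E E' Z Z' : ℝ≥0} {T T' : ℝ} (hE : E ≤ E') (hZ : Z ≤ Z')
    (hT : T ≤ T') : maxEnstrophy ν E Z T ≤ maxEnstrophy ν E' Z' T' :=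
  sSup_le_sSup (enstrophyValues_mono hE hZ hT)

/-- The maximal enstrophy is **attained** at budget `(E, Z)` and horizon `T`: some admissible
trajectory within budget realises `𝒵_ν(E, Z, T)` at an observation time (the existence question
for the finite-time extreme-enstrophy problem, Ayala–Protas 2017, §2; open in general).
[cite: AyalaProtas2017, §2] -/
def IsMaxEnstrophyAttained (ν : ℝ) (E Z : ℝ≥0) (T : ℝ) : Prop :=
  ∃ (T' : ℝ) (u : ℝ → ℝ³ → ℝ³) (t : ℝ), IsLerayHopfTrajectory ν T' u ∧
    eEnergy (u 0) ≤ E ∧ eWeakGradL2Sq (u 0) ≤ Z ∧ 0 ≤ t ∧ t ≤ T ∧ t < T' ∧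
    eWeakGradL2Sq (u t) = maxEnstrophy ν E Z T

end Trajectories

section ProfileSplit

/-- **Data of a profile splitting** with `J` profiles (Gérard 1998, Thm. 1.1, translation part;
Gallagher 2001, Thm. 1): fixed profiles `φ j`, frames `x n j`, remainders `r n`, and the
trajectories `u n` with lifespans `T' n` and observation times `t n` they belong to.
[cite: Gerard1998, Thm. 1.1] -/
structure ProfileSplitData (J : ℕ) where
  /-- The profiles. -/
  φ : Fin J → ℝ³ → ℝ³
  /-- The frames (translation cores) of the profiles along the sequence. -/
  x : ℕ → Fin J → ℝ³
  /-- The remainders. -/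
  r : ℕ → ℝ³ → ℝ³
  /-- The lifespans of the trajectories. -/
  T' : ℕ → ℝ
  /-- The trajectories. -/
  u : ℕ → ℝ → ℝ³ → ℝ³
  /-- The observation times. -/
  t : ℕ → ℝ

/-- **Profile-split sequence at budget `(E, Z)`, horizon `T`, precision `ε`**: a sequence of
admissible trajectories within budget, observed inside the window, whose DATA decompose as
`u n 0 = Σ_j φ j (· - x n j) + r n` with: `L²`, weakly divergence-free profiles of energy `≤ E`;
frames drifting apart; remainders asymptotically `L²`-weakly null in every profile frame;
`limsup_n ‖r n‖_{L³} ≤ ε` (smallness in the critical Lebesgue norm: Lions 1984, Lemma I.1,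
vanishing ⟹ `L^p`-null for `2 < p < 6`); and asymptotic orthogonality of the enstrophy budget,
`Σ_j ‖∇φ j‖² + limsup_n ‖∇r n‖² ≤ Z` (Gérard 1998, Thm. 1.1 (1.7); Gallagher 2001, Thm. 1 and
(1.10) for Navier–Stokes data). The SHAPE only; no existence is asserted.
[cite: Gallagher2001, Thm. 1] -/
structure IsProfileSplitSequence (ν : ℝ) (E Z : ℝ≥0) (T ε : ℝ) {J : ℕ}
    (D : ProfileSplitData J) : Prop where
  /-- Each `u n` is an admissible trajectory with lifespan `T' n`. -/
  traj : ∀ n, IsLerayHopfTrajectory ν (D.T' n) (D.u n)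
  /-- Energy budget of the data. -/
  energy_le : ∀ n, eEnergy (D.u n 0) ≤ E
  /-- Enstrophy budget of the data. -/
  enstrophy_le : ∀ n, eWeakGradL2Sq (D.u n 0) ≤ Z
  /-- Observation times inside the window and the lifespan. -/
  time_mem : ∀ n, 0 ≤ D.t n ∧ D.t n ≤ T ∧ D.t n < D.T' n
  /-- Profiles are square integrable. -/
  profile_memLp : ∀ j, MemLp (D.φ j) 2 volume
  /-- Profiles are weakly divergence free. -/
  profile_divFree : ∀ j, IsWeaklyDivFree (D.φ j)
  /-- Profiles respect the energy budget (weak lower semicontinuity of the `L²` norm). -/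
  profile_energy_le : ∀ j, eEnergy (D.φ j) ≤ E
  /-- The data split into translated profiles plus remainder. -/
  decomposition : ∀ n y, D.u n 0 y = (∑ j, D.φ j (y - D.x n j)) + D.r n y
  /-- Distinct frames drift apart. -/
  frames_diverge : ∀ j k, j ≠ k → Tendsto (fun n => ‖D.x n j - D.x n k‖) atTop atTop
  /-- The remainder, read in any profile frame, tends to zero weakly in `L²`. -/
  weakly_orthogonal : ∀ (j : Fin J) (w : ℝ³ → ℝ³), MemLp w 2 volume →
    Tendsto (fun n => ∫ y, ⟪D.r n (y + D.x n j), w y⟫) atTop (𝓝 0)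
  /-- The remainder is eventually `ε`-small in the critical norm `L³`. -/
  remainder_small : limsup (fun n => eLpNorm (D.r n) 3 volume) atTop ≤ ENNReal.ofReal ε
  /-- Asymptotic orthogonality of the enstrophy budget. -/
  budget_orthogonal :
    (∑ j, eWeakGradL2Sq (D.φ j)) + limsup (fun n => eWeakGradL2Sq (D.r n)) atTop ≤ Z

/-- In a profile-split sequence every single profile respects the enstrophy budget. [folklore] -/
theorem IsProfileSplitSequence.eWeakGradL2Sq_profile_le {ν T ε : ℝ} {E Z : ℝ≥0} {J : ℕ}
    {D : ProfileSplitData J} (h : IsProfileSplitSequence ν E Z T ε D) (j : Fin J) :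
    eWeakGradL2Sq (D.φ j) ≤ Z :=
  ((Finset.single_le_sum (f := fun j => eWeakGradL2Sq (D.φ j)) (fun _ _ => zero_le)
    (Finset.mem_univ j)).trans le_self_add).trans h.budget_orthogonal

end ProfileSplit

end Literature.Analysis.FluidPDE

end
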